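import Literature.MathematicalPhysics.QuantumFieldTheory.Balaban1983to89.T4FiniteEpsInhabited
import Literature.MathematicalPhysics.QuantumFieldTheory.Balaban1983to89.Node00.DatumAvLayer

/-!
# A SECOND labelled placeholder in `FiniteEpsData F G`: the FLAT datum — at which the pinned end statement (B) HOLDS, trivially.
# Kernel witness that every CLOSED `∃`-statement «some datum of record (Stage 0) satisfies (B) ∕ endpoint existence» is junk-true

Scope: the Bałaban audit ∕ YM-PLAN Track A bookkeeping (pub-ymgap seat `dag-n23-b`, node N23 = binder B1; tree home of the detail route
«BalabanUVNodes» per chair R424; filed `--supports stmt-QuantumFields-19183`, the route's crux `StabilityBAtRecord`).  Bookkeeping ∕ typing only; NO analytic content of the series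
is proved or asserted.  HONEST FRAMING — READ FIRST: this module builds a JUNK inhabitant of the data type, labelled as such field by
field, in the manner of `T4FiniteEpsInhabited.stubData` (at which (B) is FALSE, `T4FiniteEpsInhabited.not_endStatementBPrinted_stub`);
the new inhabitant is chosen so that (B) as typed is TRUE at it.  Its purpose is NEGATIVE INFORMATION about statements, not progress on
any theorem: it certifies in the kernel that the NODE 00 Stage-0 record predicate `Node00.IsDatumOfRecord₀` (which pins the averaging
maps `D.av` ONLY) does not stop the `∃ D, IsDatumOfRecord₀ F N D ∧ B16.EndStatementBPrinted D.C ∧ …` faces of (B) and of endpoint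
existence from holding for a reason unrelated to Bałaban's densities.  One finite four-torus programme at fixed `ε`; nothing about the
continuum limit, `ℝ⁴`, infinite volume, OS axioms, a mass gap or the Clay problem.

## The flat datum (every field labelled)
For a lattice family `F`, a regular gauge group `G` and ANY measurable averaging family `av K j` with `HaarAC` in the standing range:
* `av` = the GIVEN averagings — at `av := Node00.avOfRecord F N` (Bałaban's (0.4) block averaging with the printed exp-mean-log on
  `SU(N)`) the datum is «of record, Stage 0» BY `rfl` (`isDatumOfRecord₀_flatDatumSU`);
* construction `flatConstruction`: CONSTANT coupling flow `g_k = g₀`, zero β-functions (as the old placeholder); `Cfg k` = gauge fields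
  on `T^{(k)}` of the `K`-th torus; densities `ρ₀ = exp(−A(U)/g₀²)` (the Wilson–Boltzmann weight, HONEST start, [Balaban1988Convergent]
  Thm 1 p. 262 with `E = 0`) and `ρ_k ≡ Z_ε = ∫ρ₀ dU` CONSTANT for every `k ≥ 1` (`flatTower`); `χ_k :≡ 0`, `numSites :≡ 0`,
  `wilsonBG = effAction = Ek :≡ 0`, `dom := univ`, and the three ABSTRACT PROPOSITIONAL FIELDS `Repr`, `IndAss`, `Sect2Form :≡ True` —
  the flat datum asserts none of Bałaban's representations yet its propositional fields are «satisfied»;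
* realisation `flatRealisation`: `cfg` = identity, `ρ₀` = the Boltzmann weight (`c = 1`), `Tρ_k` = the honest Radon–Nikodym transport
  `AveragingRT.rnTransport` along `av K k` (`Setup.IsRT` by `T4FiniteEpsInhabited.isRT_rnTransport_of_ac`), and the large-field
  operation `R :=` FLATTENING `ρ ↦ (V ↦ ∫ρ dV)` (`flatten`) — integral-preserving on the probability space of fields
  (`preservesIntegral_flatten`), which is ALL the dictionary `T4Continuum.Realisation` asks of `R` ([Balaban1989LargeFieldI] (0.4)
  p. 176 "integrals of the densities are unchanged"); `ρ_{k+1} = R(Tρ_k)` then holds because `∫Tρ_k = ∫ρ_k = Z_ε` (`rho_succ_eq` via the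
  push-forward identity at `f ≡ 1`).

## What is TRUE at the flat datum, as typed (§3–§4) — and why
* `B16.Thm1Printed` ([Balaban1989LargeFieldII] Thm 1 p. 355 as typed: `∃ γ > 0, ∀ runs in ]0,γ], ∀ k ≤ K, Sect2Form k`) — because
  `Sect2Form :≡ True` is an abstract field (`thm1Printed_flat`);
* `B16.Cor3_250` and the run-uniform `B16.UVBound01` ([Balaban1988Convergent] Cor. 3 (2.50) p. 264 ∕ [Balaban1989LargeFieldII] (0.1)) with
  `E₋ = E₊ = 0` — because `χ ≡ 0` voids the lower bound and `0 ≤ ρ_k ≤ 1` (`cor3_250_flat`, `uvBound01_flat`); hence (B) pinned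
  `B16.EndStatementBPrinted` and the stronger `B16.EndStatementB` (`endStatementBPrinted_flat`, `endStatementB_flat`);
* `B12.Thm1Printed` of the small-field part ([Balaban1987RG1] Thm 1 p. 259 as typed) — `Repr :≡ True` (`b12Thm1Printed_flat`);
* `DagBinding.EndpointExistence` (the endpoint half of [Balaban1987RG1] Thm 2 p. 259) — the constant flow started at `g₀ = g ≤ γ` stays in
  `]0, γ]` and ends at `g` (`endpointExistence_flat`); and the «window» clause of the crux (zero-step runs, `window_flat`).
NOT true there (content survives): the logarithmic running (0.31) (a constant flow has none for `K ≥ 1`) and every statement about the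
Wilson expectations `D.scheme` (the spine slot `T4ApexHybrid.HybridNE7Under`, the targets), which do not read `D.C` at all.

## Consequence recorded (§4), for the planner ∕ referee
At `G = SU(N)`, every `N ≥ 1`, every four-torus family: `∃ D, Node00.IsDatumOfRecord₀ F N D ∧ B16.EndStatementBPrinted D.C ∧ (window)`
(`exists_isDatumOfRecord₀_endStatementBPrinted_window` — at `N = 2` the matrix of route item stmt-QuantumFields-19183 `StabilityBAtRecord F`)
and `∃ D, Node00.IsDatumOfRecord₀ F N D ∧ B16.EndStatementBPrinted D.C ∧ DagBinding.EndpointExistence D.C.toB12`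
(`exists_isDatumOfRecord₀_endStatementBPrinted_endpoint` — at `N = 2` the conclusion of stmt-QuantumFields-19181 `EndpointGivenB F`) hold BY
THE FLAT DATUM.  Reading: a closed `∃`-statement over the Stage-0 frame is as weak as its weakest admissible construction (the route's own
caveat, `BalabanUVNodes` «why it might fail» of `StabilityBAtRecord`); the dual of the dagwriter's `not_paperClusters_over_stage2Frame`
(closed `∀`-statements over an unpinned frame are junk-REFUTABLE) is that closed `∃`-statements over it are junk-PROVABLE.  The repair is
the one the route names: restate over NODE 00's Stage-5 record predicate pinning `D.C`, `βfun`, `R` (R422 «DEFINITION FIRST»), or keep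
the rungs informal-until-pinned (R421 (P2)).  This module proves nothing about which.
-/

noncomputable section

open MeasureTheory

namespace Summit.QuantumFields.YangMills.Theorems.BalabanUVNodesStage0FlatWitness

open Literature.MathematicalPhysics.QuantumFieldTheory.Balaban1983to89
open Literature.MathematicalPhysics.QuantumFieldTheory.Balaban1983to89.Missing
open Literature.MathematicalPhysics.QuantumFieldTheory.Balaban1983to89.AveragingRT
open Literature.MathematicalPhysics.QuantumFieldTheory.Balaban1983to89.T4Continuum
open Literature.MathematicalPhysics.QuantumFieldTheory.Balaban1983to89.T4FiniteEpsInhabited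

/-! ## 1. Flattening: the integral-preserving operation `ρ ↦ (V ↦ ∫ρ dV)` and the flat tower of densities -/

section Flat

variable {P : Params} {j : ℕ} {G : Type*} [GaugeGroup G] [MeasurableSpace G] [HaarData G]

/-- FLATTENING of densities on `T^{(j)}`-fields: `ρ ↦` the constant function `∫ρ dV`.  A JUNK stand-in for Bałaban's large-field operation
`R` — it satisfies the one property the dictionary `T4Continuum.Realisation` types of `R`, (0.4) of [Balaban1989LargeFieldI], and nothing
else of [Balaban1989LargeFieldI]∕[II]. [cite: Balaban1989LargeFieldI, (0.4) p.176 (the normalisation property ONLY; the operation here is a labelled placeholder)] -/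
def flatten (ρ : Density P j G) : Density P j G := fun _ => ∫ V, ρ V ∂fieldMeasure P j G

/-- Flattening preserves integrals: `∫(∫ρ) dV = ∫ρ` on the probability space of fields ((0.4) "∫dV(Rρ)(V) = ∫dVρ(V)"). [cite: Balaban1989LargeFieldI, (0.4) p.176] -/
theorem preservesIntegral_flatten : PreservesIntegral (flatten : Density P j G → Density P j G) := fun ρ => by
  simp [flatten]

/-- Flattening a pointwise non-negative density gives a non-negative constant. [folklore] -/
theorem flatten_nonneg (ρ : Density P j G) (h0 : ∀ V, 0 ≤ ρ V) (V : GaugeField P j G) : 0 ≤ flatten ρ V :=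
  integral_nonneg h0

end Flat

section Tower

variable (F : T4Family) (G : Type*) [GaugeGroup G] [MeasurableSpace G] [HaarData G]

/-- THE FLAT TOWER of densities of the run `(K, g₀)`: `ρ₀ = exp(−A(U)/g₀²)` (the Wilson–Boltzmann weight at `β = g₀⁻²`, honest) and
`ρ_k ≡ Z_ε := ∫ρ₀ dU` (the partition function, a CONSTANT) for every `k ≥ 1` — what `(R T)^k ρ₀` of [Balaban1988Convergent] (0.2) becomes
when `R` is the junk flattening. [cite: Balaban1988Convergent, (0.2) p.244 (shape only; R is the placeholder `flatten`)] -/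
def flatTower (K : ℕ) (g₀ : ℝ) : (k : ℕ) → Density (F.P K) k G
  | 0 => boltzmann (F.P K) (g₀⁻¹ ^ 2)
  | _ + 1 => fun _ => partitionFn (G := G) (F.P K) (g₀⁻¹ ^ 2)

/-- `ρ₀` is the Boltzmann weight. [folklore] -/
theorem flatTower_zero (K : ℕ) (g₀ : ℝ) : flatTower F G K g₀ 0 = boltzmann (F.P K) (g₀⁻¹ ^ 2) := rfl

/-- `ρ_{k+1} ≡ Z_ε`. [folklore] -/
theorem flatTower_succ (K : ℕ) (g₀ : ℝ) (k : ℕ) (V : GaugeField (F.P K) (k + 1) G) :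
    flatTower F G K g₀ (k + 1) V = partitionFn (G := G) (F.P K) (g₀⁻¹ ^ 2) := rfl

/-- Every level of the flat tower is pointwise non-negative (`Z_ε ≥ 0` as the integral of a positive weight). [folklore] -/
theorem flatTower_nonneg (K : ℕ) (g₀ : ℝ) : ∀ (k : ℕ) (V : GaugeField (F.P K) k G), 0 ≤ flatTower F G K g₀ k V
  | 0, V => (boltzmann_pos (F.P K) _ V).le
  | _ + 1, _ => integral_nonneg fun U => (boltzmann_pos (F.P K) _ U).le

/-- The integral of every level is `Z_ε` (level `0` by definition of `Missing.partitionFn`, higher levels as constants). [folklore] -/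
theorem integral_flatTower (K : ℕ) (g₀ : ℝ) :
    ∀ k : ℕ, ∫ V, flatTower F G K g₀ k V ∂fieldMeasure (F.P K) k G = partitionFn (G := G) (F.P K) (g₀⁻¹ ^ 2)
  | 0 => rfl
  | _ + 1 => by simp [flatTower]

variable [RegularGaugeGroup G]

/-- `Z_ε ≤ 1` for `β ≥ 0`: the Boltzmann weight is at most `1` on a probability space. [folklore] -/
theorem partitionFn_le_one (P : Params) {β : ℝ} (hβ : 0 ≤ β) : partitionFn (G := G) P β ≤ 1 := by
  have h := integral_mono (integrable_boltzmann (G := G) RegularGaugeGroup.measurable_reTr P hβ) (integrable_const (1 : ℝ))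
    fun U => boltzmann_le_one P hβ U
  simpa [partitionFn] using h

/-- Every level of the flat tower is pointwise at most `1`. [folklore] -/
theorem flatTower_le_one (K : ℕ) (g₀ : ℝ) : ∀ (k : ℕ) (V : GaugeField (F.P K) k G), flatTower F G K g₀ k V ≤ 1
  | 0, V => boltzmann_le_one (F.P K) (sq_nonneg _) V
  | _ + 1, _ => partitionFn_le_one G (F.P K) (sq_nonneg _)

/-- Every level of the flat tower is integrable (the Boltzmann weight; constants on a probability space). [folklore] -/
theorem integrable_flatTower (K : ℕ) (g₀ : ℝ) :
    ∀ k : ℕ, Integrable (flatTower F G K g₀ k) (fieldMeasure (F.P K) k G)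
  | 0 => integrable_boltzmann RegularGaugeGroup.measurable_reTr (F.P K) (sq_nonneg _)
  | _ + 1 => integrable_const _

end Tower

/-! ## 2. The flat construction, its forward generation, its realisation, the flat datum -/

section Construction

variable (F : T4Family) (G : Type) [GaugeGroup G] [MeasurableSpace G] [HaarData G]
  (av : (K j : ℕ) → Averaging (F.P K) j G)

/-- THE FLAT CONSTRUCTION (JUNK, every field labelled in the module docstring): constant coupling flow with zero β-functions, gauge fields
as configurations, the flat tower as densities, `χ ≡ 0`, `numSites ≡ 0`, zero actions, `dom = univ`, and the abstract propositional
fields `Repr`, `IndAss`, `Sect2Form` all `True`.  It asserts NONE of [Balaban1987RG1] (0.22)–(0.24) or [Balaban1988Convergent] §2. [cite: Balaban1989LargeFieldII, Thm 1 + (0.1) pp.355–356 (statement-level carrier only; a labelled placeholder at which the typed form holds trivially)] -/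
def flatConstruction : B16.Construction := fun p =>
  { flow := ⟨fun _ => p.g0, fun _ _ => 0⟩
    Cfg := fun k => GaugeField (F.P p.K) k G
    dom := fun _ => Set.univ
    effAction := fun _ _ => 0
    wilsonBG := fun _ _ => 0
    Ek := fun _ _ => 0
    numSites := fun _ => 0
    Repr := fun _ => True
    IndAss := fun _ => True
    ρ := fun k => flatTower F G p.K p.g0 k
    χ := fun _ _ => 0
    Sect2Form := fun _ => True }

/-- The flat construction's one-variable β-functions are the zero family curried (both sides are `0`). [folklore] -/
theorem curriesHBeta_flat : DagBinding.CurriesHBeta (flatConstruction F G).toB12 zeroHBeta :=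
  fun _ _ _ _ => rfl

/-- The constant flow is generated forward from the bare coupling by the zero β-functions ([Balaban1987RG1] (0.20) with `β ≡ 0`). [cite: Balaban1987RG1, (0.20) p.256 (degenerate instance β ≡ 0)] -/
theorem forwardGenerated_flat : DagBinding.ForwardGenerated (flatConstruction F G).toB12 zeroHBeta := by
  refine ⟨fun _ => rfl, fun p k _ hpos _ => ?_⟩
  have h0 : 0 < p.g0 := hpos 0 (Nat.zero_le _)
  refine ⟨h0, ?_⟩
  show 1 / p.g0 ^ 2 = 1 / p.g0 ^ 2 - 0
  rw [sub_zero]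

/-- `χ_k ≥ 0` holds (with `χ ≡ 0`). [folklore] -/
theorem signConventions_flat : B16.SignConventions (flatConstruction F G) := fun _ _ _ => le_rfl

variable [RegularGaugeGroup G]

/-- THE FLAT REALISATION along the given averagings: `cfg` = identity, `ρ₀` = the Boltzmann weight (`c = 1`), `Tρ_k` = the honest
Radon–Nikodym transport along `av K k` (a `Setup.IsRT` transform for `k < K` under measurability + `HaarAC`), `R` = FLATTENING (junk;
(0.4) holds), and `ρ_{k+1} = R(Tρ_k)` because `∫Tρ_k = ∫ρ_k = Z_ε`. [cite: Balaban1988Convergent, (0.2) p.244 (dictionary shape; R is the placeholder `flatten`)] -/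
def flatRealisation (hmeas : ∀ K j, Measurable (av K j).avg) (hac : ∀ K k, k < K → HaarAC (av K k).avg) :
    Realisation F G (flatConstruction F G) av where
  cfg := fun _ _ _ => Equiv.refl _
  rho_zero := fun _ _ => ⟨1, one_pos, fun _ => (one_mul _).symm⟩
  Trho := fun K g₀ k => rnTransport (av K k).avg (flatTower F G K g₀ k)
  isRT_Trho := fun K g₀ k hk =>
    isRT_rnTransport_of_ac _ (hmeas K k) (hac K k hk) _ (integrable_flatTower F G K g₀ k)
  R := fun _ _ _ => flatten
  preservesIntegral_R := fun _ _ _ _ => preservesIntegral_flatten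
  rho_succ_eq := fun K g₀ k hk => by
    funext V
    show partitionFn (G := G) (F.P K) (g₀⁻¹ ^ 2) =
      ∫ W, rnTransport (av K k).avg (flatTower F G K g₀ k) W ∂fieldMeasure (F.P K) (k + 1) G
    have h := isRT_rnTransport_of_ac _ (hmeas K k) (hac K k hk) _ (integrable_flatTower F G K g₀ k)
      (fun _ => (1 : ℝ)) measurable_const ⟨1, fun _ => by simp⟩
    simp only [mul_one] at h
    rw [h, integral_flatTower]

/-- THE FLAT DATUM: finite-`ε` data with the GIVEN averagings, realised on the flat construction — a labelled JUNK inhabitant of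
`FiniteEpsData F G` at which (B) as typed HOLDS (§3). [cite: Balaban1989LargeFieldII, Thm 1 + (0.1) pp.355–356 (carrier inhabitant; honesty label in the module docstring)] -/
def flatData (hmeas : ∀ K j, Measurable (av K j).avg) (hac : ∀ K k, k < K → HaarAC (av K k).avg) : FiniteEpsData F G where
  C := flatConstruction F G
  βfun := zeroHBeta
  curries := curriesHBeta_flat F G
  fwd := forwardGenerated_flat F G
  av := av
  real := flatRealisation F G av hmeas hac

/-- Its averagings are the given ones. [folklore] -/
@[simp] theorem flatData_av (hmeas : ∀ K j, Measurable (av K j).avg) (hac : ∀ K k, k < K → HaarAC (av K k).avg) :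
    (flatData F G av hmeas hac).av = av := rfl

/-- Its construction is the flat one. [folklore] -/
@[simp] theorem flatData_C (hmeas : ∀ K j, Measurable (av K j).avg) (hac : ∀ K k, k < K → HaarAC (av K k).avg) :
    (flatData F G av hmeas hac).C = flatConstruction F G := rfl

end Construction

/-! ## 3. What holds at the flat construction, AS TYPED — trivially (the honesty certificates of this placeholder) -/

section JunkTrue

variable (F : T4Family) (G : Type) [GaugeGroup G] [MeasurableSpace G] [HaarData G]

/-- [Balaban1989LargeFieldII] Thm 1 AS TYPED (`B16.Thm1Printed`) HOLDS at the flat construction — because its conclusion `Sect2Form k` is an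
abstract propositional field, here `True`.  A statement about the typed carrier, NOT about the paper. [cite: Balaban1989LargeFieldII, Thm 1 p.355 (typed form; holds trivially at the placeholder)] -/
theorem thm1Printed_flat : B16.Thm1Printed (flatConstruction F G) :=
  ⟨1, one_pos, fun _ _ _ _ => trivial⟩

/-- [Balaban1987RG1] Thm 1 AS TYPED for the small-field part (`B12.Thm1Printed C.toB12`: `Repr k` along runs in `]0, γ]`) HOLDS at the flat
construction — `Repr :≡ True`. [cite: Balaban1987RG1, Thm 1 p.259 (typed form; holds trivially at the placeholder)] -/
theorem b12Thm1Printed_flat : B12.Thm1Printed (flatConstruction F G).toB12 :=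
  ⟨1, one_pos, fun _ _ _ _ => trivial⟩

/-- **ENDPOINT EXISTENCE AS TYPED HOLDS AT THE FLAT CONSTRUCTION** (`DagBinding.EndpointExistence`, the endpoint half of [Balaban1987RG1]
Thm 2 p. 259): for every `m`, `γ ≤ 1`, `g ≤ γ` and `K` the constant run started at `g₀ = g` stays in `]0, γ]` and ends at `g_K = g`. [cite: Balaban1987RG1, Thm 2 p.259 (endpoint clause, typed form; holds trivially at the placeholder)] -/
theorem endpointExistence_flat : DagBinding.EndpointExistence (flatConstruction F G).toB12 :=
  fun _ => ⟨1, one_pos, fun γ hγ _ => ⟨γ, hγ, fun g hg hgγ _ => ⟨g, fun _ _ => ⟨hg, hgγ⟩, rfl⟩⟩⟩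

/-- The «window» clause of the crux `StabilityBAtRecord` — runs of the construction enter every coupling window `]0, γ]`, `γ ≤ 1` — holds at the
flat construction by its zero-step runs `(K, m, g₀) = (0, F.m, γ)` (as at EVERY forward-generated datum, `Node00.N24Glue` §4). [cite: Balaban1987RG1, (0.17) p.255 (zero-step runs; bookkeeping)] -/
theorem window_flat : ∃ γ₁ : ℝ, 0 < γ₁ ∧ ∀ γ : ℝ, 0 < γ → γ ≤ γ₁ →
    ∃ P : B12.RunParams, ((flatConstruction F G) P).flow.InInterval γ P.K :=
  ⟨1, one_pos, fun γ hγ _ => ⟨⟨0, F.m, γ⟩, fun _ _ => ⟨hγ, le_rfl⟩⟩⟩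

/-- What is NOT junk-true there: the logarithmic running (0.31) of [Balaban1987RG1] Thm 2 FAILS for the constant flow as soon as `K ≥ 1`
(at `k = 0` it would force `β · log L^K ≤ 0` with `β > 0`, `L > 1`) — so `B12.Thm2Printed` keeps content at Stage 0 even at the flat datum;
recorded on the family's `K`-th torus (`ε = L^{-K}`) at the run's own endpoint `g = g₀`. [cite: Balaban1987RG1, Thm 2 (0.31) p.259] -/
theorem not_logRunning_flat (K m : ℕ) (hK : 1 ≤ K) (g₀ β β' : ℝ) (hβ : 0 < β) :
    ¬ ((flatConstruction F G) ⟨K, m, g₀⟩).flow.LogRunning (F.P K) g₀ β β' := by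
  intro h
  have h0 := (h 0 (Nat.zero_le _)).1
  have hg0 : ((flatConstruction F G) ⟨K, m, g₀⟩).flow.g 0 = g₀ := rfl
  have heps : ((((F.P K).L : ℝ) ^ (0 : ℕ)) * (F.P K).eps)⁻¹ = (F.L : ℝ) ^ K := by
    simp [Params.eps]
  rw [hg0, heps] at h0
  have hL : (1 : ℝ) < (F.L : ℝ) := by exact_mod_cast F.hL.2
  have hlog : 0 < Real.log ((F.L : ℝ) ^ K) := by
    rw [Real.log_pow]
    exact mul_pos (by exact_mod_cast hK) (Real.log_pos hL)
  linarith [mul_pos hβ hlog]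

variable [RegularGaugeGroup G]

/-- [Balaban1988Convergent] Cor. 3 (2.50) AS TYPED (`B16.Cor3_250`) HOLDS at the flat construction with `e₋ = e₊ ≡ 0`: `χ ≡ 0` voids the
lower bound (`0 ≤ ρ_k`) and `ρ_k ≤ 1 = e^0`. [cite: Balaban1988Convergent, Cor. 3 (2.50) p.264 (typed form; holds trivially at the placeholder)] -/
theorem cor3_250_flat : B16.Cor3_250 (flatConstruction F G) := by
  refine ⟨1, one_pos, fun _ => 0, fun _ => 0, fun P _ k _ V => ⟨?_, ?_⟩⟩
  · show (0 : ℝ) * _ ≤ flatTower F G P.K P.g0 k V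
    rw [zero_mul]
    exact flatTower_nonneg F G P.K P.g0 k V
  · show flatTower F G P.K P.g0 k V ≤ Real.exp (0 * ((0 : ℕ) : ℝ))
    rw [zero_mul, Real.exp_zero]
    exact flatTower_le_one F G P.K P.g0 k V

/-- The run-uniform reading (0.1) AS TYPED (`B16.UVBound01`, `E₋ = E₊ = 0`) HOLDS at the flat construction likewise. [cite: Balaban1989LargeFieldII, (0.1) pp.355–356 (typed form; holds trivially at the placeholder)] -/
theorem uvBound01_flat : B16.UVBound01 (flatConstruction F G) := by
  refine ⟨1, one_pos, 0, 0, fun P _ k _ V => ⟨?_, ?_⟩⟩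
  · show (0 : ℝ) * _ ≤ flatTower F G P.K P.g0 k V
    rw [zero_mul]
    exact flatTower_nonneg F G P.K P.g0 k V
  · show flatTower F G P.K P.g0 k V ≤ Real.exp (0 * ((0 : ℕ) : ℝ))
    rw [zero_mul, Real.exp_zero]
    exact flatTower_le_one F G P.K P.g0 k V

/-- **THE PINNED END STATEMENT (B) AS TYPED HOLDS AT THE FLAT CONSTRUCTION** (`B16.EndStatementBPrinted = Thm1Printed ∧ Cor3_250`). [cite: Balaban1989LargeFieldII, Thm 1 + (0.1) pp.355–356 (typed form; holds trivially at the placeholder)] -/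
theorem endStatementBPrinted_flat : B16.EndStatementBPrinted (flatConstruction F G) :=
  ⟨thm1Printed_flat F G, cor3_250_flat F G⟩

/-- The stronger form `B16.EndStatementB = Thm1Printed ∧ UVBound01` holds there too. [cite: Balaban1989LargeFieldII, Thm 1 + (0.1) pp.355–356 (typed form; holds trivially at the placeholder)] -/
theorem endStatementB_flat : B16.EndStatementB (flatConstruction F G) :=
  ⟨thm1Printed_flat F G, uvBound01_flat F G⟩

end JunkTrue

/-! ## 4. At `SU(N)` with the averaging of record: the closed `∃`-faces of (B) and of endpoint existence over Stage 0 are junk-true -/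

section Record

open Literature.MathematicalPhysics.QuantumFieldTheory.Balaban1983to89.Node00

variable (F : T4Family) (N : ℕ) [NeZero N]

/-- THE FLAT DATUM OF RECORD (Stage 0): the flat datum driven by Bałaban's averaging of record `Node00.avOfRecord F N` on `SU(N)` (measurable,
`HaarAC` in the standing range — `Node00.avOfRecord_measurable ∕ _haarAC`).  JUNK beyond its `av` field. [cite: Balaban1987RG1, (0.4) p.253 (the averaging field only; every other field is the labelled placeholder)] -/
def flatDatumSU : FiniteEpsData F (Matrix.specialUnitaryGroup (Fin N) ℂ) :=
  flatData F (Matrix.specialUnitaryGroup (Fin N) ℂ) (avOfRecord F N) (avOfRecord_measurable F N) (avOfRecord_haarAC F N)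

/-- The flat datum IS «a datum of record, Stage 0» — `IsDatumOfRecord₀` reads `D.av` only (`rfl`). [cite: Balaban1987RG1, (0.4) p.253 (Stage-0 record predicate; bookkeeping)] -/
theorem isDatumOfRecord₀_flatDatumSU : IsDatumOfRecord₀ F N (flatDatumSU F N) := rfl

/-- … hence printed-averaged (binder B1 holds at it, as at every Stage-0 datum). [cite: Balaban1987RG1, (0.4) p.253] -/
theorem isPrintedAveraged_flatDatumSU : (flatDatumSU F N).IsPrintedAveraged :=
  isPrintedAveraged_of_isDatumOfRecord₀ F N _ (isDatumOfRecord₀_flatDatumSU F N)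

/-- … and (B) AS TYPED holds at it. [cite: Balaban1989LargeFieldII, Thm 1 + (0.1) pp.355–356 (typed form; holds trivially at the placeholder)] -/
theorem endStatementBPrinted_flatDatumSU : B16.EndStatementBPrinted (flatDatumSU F N).C :=
  endStatementBPrinted_flat F _

/-- … and endpoint existence AS TYPED holds at it. [cite: Balaban1987RG1, Thm 2 p.259 (endpoint clause, typed form; holds trivially at the placeholder)] -/
theorem endpointExistence_flatDatumSU : DagBinding.EndpointExistence (flatDatumSU F N).C.toB12 :=
  endpointExistence_flat F _

/-- **KERNEL WITNESS №1 — the closed `∃`-face of (B) over Stage 0 is junk-true**: on every four-torus family and every `N ≥ 1` SOME datum of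
record (Stage 0) has a construction satisfying (B) as typed, with runs in every coupling window `]0, γ]`, `γ ≤ 1` — namely the FLAT datum.
At `N = 2` this is VERBATIM the matrix of the detail route's crux `Summit.QuantumFields.YangMills.Theses.BalabanUVNodes.StabilityBAtRecord F`
(item stmt-QuantumFields-19183), which this Literature module cannot name.  NEGATIVE INFORMATION about the statement (it does not yet express
«(B) for Bałaban's densities»), not a discharge of anything. [cite: Balaban1989LargeFieldII, Thm 1 + (0.1) pp.355–356 (typed ∃-face over the Stage-0 record predicate; junk-true)] -/
theorem exists_isDatumOfRecord₀_endStatementBPrinted_window :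
    ∃ D : FiniteEpsData F (Matrix.specialUnitaryGroup (Fin N) ℂ), IsDatumOfRecord₀ F N D ∧ B16.EndStatementBPrinted D.C ∧
      ∃ γ₁ : ℝ, 0 < γ₁ ∧ ∀ γ : ℝ, 0 < γ → γ ≤ γ₁ → ∃ P : B12.RunParams, (D.C P).flow.InInterval γ P.K :=
  ⟨flatDatumSU F N, isDatumOfRecord₀_flatDatumSU F N, endStatementBPrinted_flatDatumSU F N, window_flat F _⟩

/-- **KERNEL WITNESS №2 — the closed `∃`-face of (B) ∧ endpoint existence over Stage 0 is junk-true**: on every family and every `N ≥ 1` SOME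
datum of record (Stage 0) satisfies (B) as typed AND `DagBinding.EndpointExistence` — the flat datum again.  At `N = 2` this is VERBATIM the
conclusion of the crux `…BalabanUVNodes.EndpointGivenB F` (item stmt-QuantumFields-19181), obtained WITHOUT its hypothesis; the content of
[Balaban1987RG1] Thm 2 is therefore not expressed by that `∃`-face either (its (0.31) half is — `not_logRunning_flat`). [cite: Balaban1987RG1, Thm 2 p.259 (typed ∃-face of the endpoint clause over the Stage-0 record predicate; junk-true)] -/
theorem exists_isDatumOfRecord₀_endStatementBPrinted_endpoint :
    ∃ D : FiniteEpsData F (Matrix.specialUnitaryGroup (Fin N) ℂ), IsDatumOfRecord₀ F N D ∧ B16.EndStatementBPrinted D.C ∧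
      DagBinding.EndpointExistence D.C.toB12 :=
  ⟨flatDatumSU F N, isDatumOfRecord₀_flatDatumSU F N, endStatementBPrinted_flatDatumSU F N, endpointExistence_flatDatumSU F N⟩

/-- WHERE THE CONTENT SURVIVES at Stage 0 (recorded, not proved): the spine slot `T4ApexHybrid.HybridNE7Under D Hβ` and the apex targets read the
Wilson expectations `D.scheme g₀` — built from the family, the bare couplings and `D.av` ALONE (`T4Continuum.FiniteEpsData.scheme`) — so at the
flat datum they are statements about Wilson's lattice gauge theory along its tuned (here: CONSTANT, `g₀ K = g ≤ γ`) bare-coupling sequences,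
not consequences of the junk fields.  Kernel form of the remark: the flat datum's scheme is the scheme of EVERY Stage-0 datum of record with
the same family. [cite: JaffeWittenClay2006, §6.5 p.11 (the expectations whose ε → 0 limits are at issue)] -/
theorem scheme_flatDatumSU_eq (D : FiniteEpsData F (Matrix.specialUnitaryGroup (Fin N) ℂ)) (hD : IsDatumOfRecord₀ F N D)
    (g₀ : ℕ → ℝ) : (flatDatumSU F N).scheme g₀ = D.scheme g₀ := by
  unfold FiniteEpsData.scheme FiniteEpsData.avgObs
  rw [show (flatDatumSU F N).av = D.av from hD.symm ▸ rfl]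

end Record

end Summit.QuantumFields.YangMills.Theorems.BalabanUVNodesStage0FlatWitness

end
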